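import Literature.MathematicalPhysics.QuantumFieldTheory.Balaban1983to89.B15Prop1MinimiserFamilyPatching
import Literature.MathematicalPhysics.QuantumFieldTheory.Balaban1983to89.B15DeterminingSetsB

/-!
# `Balaban1983to89.B15Prop1MinimiserFamilyPatchingB` — [Balaban1985Variational] Thm 1 p. 279, Prop. 9 (190) p. 309; [Balaban1989LargeFieldI] (1.74) p. 192, Prop. 1 p. 194 (last clause); [Balaban1988Convergent]
# (2.11)–(2.14) pp. 256–257; [Balaban1984PropagatorsII] (= [II]) (2.3) p. 224: PATCHING LOCAL HOLOMORPHIC MINIMISER CHARTS INTO THE LETTER (J0′) **OVER A BOND-LEVEL DATUM** — the print-datum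
# edition of the lane's `B15Prop1MinimiserFamilyPatching` (both of its declarations with datum-bearing statements, `exists_minimiserFamily_of_localCharts` and `hMin_of_localCharts`, are used by N12's
# junction of record v14ᴸ)

statement-level skeleton of published theorems with citation tags; proofs where landed; nothing here is a claim about
the Yang–Mills mass gap

Cell `pub-ymgap` (HUMAN RULINGS D-0062 ∕ D-0149), lane `pub-ymgap-dag-n12-c` g35 (R134 seat (a), N12 = [B15], s1, lane owner); `--kind proof --supports` K1⁹ `stmt-QuantumFields-27364`;
count-neutral.  THEOREMS ONLY (0 `def`, 0 `instance`, 0 `sorry`).  (E1) variant (iii-b), class (γ) of the lane's census-by-declaration (bus [DAGN12C-G35], 2026-08-30), PURE-PARAMETER convention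
(namespace `…B`, same names, `IsMinimizer … (𝐁 : DetSet)` ↦ `IsMinimizerB … (𝔅 : BDetSet)`, proof text VERBATIM, block-extracted from the parent's tree bytes; the parent's datum-free lemmas
`differentiable_datumC_joint ∕ continuous_datumC_coeField ∕ continuous_coeField` REUSED by name; its private tube lemma is re-stated privately here because `private` does not cross modules).

HONESTY GUARD (director-ym №338 (5)).  PURELY ADDITIVE: the parent stays landed and true on its own text; nothing in it is edited; no displayed premise of any consumer is deleted or weakened.
Nothing of [15] asserted (the local charts are HYPOTHESES); count-neutral; N12 NOT discharged; K0⁷ ∕ K1⁹ NOT closed; one finite 𝕋⁴ programme at fixed ε — nothing continuum ∕ ℝ⁴ ∕ OS; the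
Yang–Mills mass gap (Clay) is NOT proved by any of this.

WHAT IS HERE.  §1 (private) `exists_uniform_radius_of_isCompact` (tube lemma, datum-free copy); §2 ★★ `exists_minimiserFamily_of_localCharts`; §3 ★★ `hMin_of_localCharts` — both over `𝔅 : BDetSet P`.

References: [15] = [Balaban1985Variational] Thm 1 p.279, Prop. 9 (190) p.309; [Balaban1989LargeFieldI] (1.74) p.192, Prop. 1 p.194; [III] = [Balaban1988Convergent] (2.11)–(2.14) pp.256–257; [II] =
[Balaban1984PropagatorsII] (2.3) p.224.
-/

noncomputable section

namespace Literature.MathematicalPhysics.QuantumFieldTheory.Balaban1983to89.B15Prop1MinimiserFamilyPatchingB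

open Set Metric Filter
open _root_.Topology
open Literature.MathematicalPhysics.QuantumFieldTheory.Balaban1983to89.Node00 (SU coeField coeField_apply)
open B15ComplexifiedDatumFamily (cfgC datumC differentiable_datumC)
open B15SU2ChartHolomorphic (expMulC differentiableAt_expMulC differentiable_qsstarGIter0)
open B15ExtensionHolomorphic (extC differentiable_extC)
open Literature.MathematicalPhysics.QuantumFieldTheory.BalabanImbrieJaffe1984to88.BIJ85Eq453GaugeField (qsstarGIter0)
open B15Prop1AnalyticExtClause (cplxVec norm_cplxVec)
open B15Prop1ChartCalculusSU2 (E3)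
open B15Prop1ChartSU2 (su2Chart)
open B16Sect1Backgrounds (expMul)
open T4CubeChartGnomonic (SU2)
open T4Continuum B15DeterminingSets B15DeterminingSetsB GaugeField
open B15Prop1MinimiserFamilyPatching (differentiable_datumC_joint continuous_coeField continuous_datumC_coeField)
open scoped Matrix.Norms.L2Operator

/-! ## §1  The tube lemma (datum-free; private copy) -/

section Topology

variable {Z S M : Type*} [PseudoMetricSpace Z] [TopologicalSpace S] [TopologicalSpace M]

/-- **ONE RADIUS FOR A COMPACT SET OF BASE POINTS** (tube lemma ∕ finite subcover).  Let `d : Z → S → M` be continuous at `(z₀, s)` for every `s` of a compact set `K`, and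
suppose that at every `s ∈ K` some OPEN set `O ∋ d z₀ s` has a property `Good`.  Then there is ONE radius `R > 0` such that every `s ∈ K` admits a good `O` containing `d z s`
for ALL `z ∈ ball z₀ R` (for each `s` a product neighbourhood `ball z₀ ε_s × B_s` is mapped into `O_s`; finitely many `B_s` cover `K`; `R = min ε_s`).  Private: a generic
point-set lemma (the tube lemma, cf. Mathlib `generalized_tube_lemma`) kept as this file's helper. [folklore] -/
private theorem exists_uniform_radius_of_isCompact {d : Z → S → M} {z₀ : Z} {K : Set S} (hK : IsCompact K) (Good : Set M → Prop)
    (hcont : ∀ s ∈ K, ContinuousAt (Function.uncurry d) (z₀, s))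
    (hloc : ∀ s ∈ K, ∃ O : Set M, IsOpen O ∧ d z₀ s ∈ O ∧ Good O) :
    ∃ R : ℝ, 0 < R ∧ ∀ s ∈ K, ∃ O : Set M, Good O ∧ ∀ z ∈ ball z₀ R, d z s ∈ O := by
  classical
  have key : ∀ s ∈ K, ∃ O : Set M, Good O ∧ ∃ ε : ℝ, 0 < ε ∧ ∃ B : Set S, B ∈ 𝓝 s ∧
      ∀ z ∈ ball z₀ ε, ∀ s' ∈ B, d z s' ∈ O := by
    intro s hs
    obtain ⟨O, hO, hmem, hgood⟩ := hloc s hs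
    have h : (Function.uncurry d) ⁻¹' O ∈ 𝓝 (z₀, s) := (hcont s hs).preimage_mem_nhds (hO.mem_nhds hmem)
    obtain ⟨A, hA, B, hB, hAB⟩ := mem_nhds_prod_iff.1 h
    obtain ⟨ε, hε, hεA⟩ := Metric.mem_nhds_iff.1 hA
    exact ⟨O, hgood, ε, hε, B, hB, fun z hz s' hs' => hAB (mk_mem_prod (hεA hz) hs')⟩
  choose! O hgood ε hε B hB hOB using key
  obtain ⟨t, htK, hcover⟩ := hK.elim_nhds_subcover B fun s hs => hB s hs
  by_cases ht : t.Nonempty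
  · obtain ⟨s₁, hs₁, hmin⟩ := t.exists_min_image ε ht
    refine ⟨ε s₁, hε s₁ (htK s₁ hs₁), fun s hs => ?_⟩
    obtain ⟨s', hs't, hss'⟩ : ∃ s' ∈ t, s ∈ B s' := by simpa only [mem_iUnion, exists_prop] using hcover hs
    exact ⟨O s', hgood s' (htK s' hs't), fun z hz => hOB s' (htK s' hs't) z (ball_subset_ball (hmin s' hs't) hz) s hss'⟩
  · refine ⟨1, one_pos, fun s hs => ?_⟩
    have h := hcover hs
    rw [Finset.not_nonempty_iff_eq_empty.1 ht] at h
    simp at h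

end Topology

/-! ## §2  Patching over a bond datum: one radius for a compact family -/

section Generic

variable {P : Params} {k : ℕ} {M : Type*} [NormedAddCommGroup M] [NormedSpace ℂ M]

/-- ★★ **(J0′) WITH ONE RADIUS FROM LOCAL HOLOMORPHIC MINIMISER CHARTS** (generic datum space).  Data: an averaging family `av`, a class `reg`, a determining set `𝔅` (the (2.12)
problem), a datum space `M` with a datum map `D : (p, B′) ↦ V_k ↦ D (p,B′) V_k` that is ℂ-differentiable in the chart parameters and jointly continuous at `((0,0), V_k)`, the real
level-0 configuration `cfg p B′ V_k` whose (2.12) datum is `avgFamily av (cfg p B′ V_k)`, and a compact set `K` of base configurations.  Hypothesis (LOCAL CHARTS): at every `V_k ∈ K`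
an open `O ∋ D 0 V_k` and a chart `Γ : M → (bond ↦ M₂(ℂ))` with entries ℂ-differentiable on `O`, bounded by `𝓐₀` on `O`, and such that at every REAL datum `D (p,B′) V′_k ∈ O` the
matrix field `Γ (D (p,B′) V′_k)` IS some `SU(2)` configuration that is a minimal configuration (`IsMinimizer`) of the (2.12) problem of the datum of `cfg p B′ V′_k`.  Conclusion:
ONE radius `R > 0` such that for EVERY `V_k ∈ K` the three clauses of the letter (J0′) hold on the sup-ball `ball 0 R` — print's «analytic function of Gᶜ-valued small configurations
V′» with a uniform smallness, here by compactness (no explicit `R`). [cite: Balaban1985Variational, Prop. 9 (190) p.309, Thm 1 p.279; Balaban1989LargeFieldI, Prop. 1 p.194 (last clause), (1.74) p.192; Balaban1988Convergent, (2.12) p.256] -/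
theorem exists_minimiserFamily_of_localCharts (av : ∀ j, Averaging P j SU2) (reg : Set (GaugeField P 0 SU2)) (𝔅 : BDetSet P)
    (D : VecField P k (EuclideanSpace ℂ (Fin 3)) × VecField P k (EuclideanSpace ℂ (Fin 3)) → GaugeField P k SU2 → M)
    (cfg : VecField P k E3 → VecField P k E3 → GaugeField P k SU2 → GaugeField P 0 SU2)
    {K : Set (GaugeField P k SU2)} (hK : IsCompact K) {𝓐₀ : ℝ}
    (hcont : ∀ Vk ∈ K, ContinuousAt (Function.uncurry D) (0, Vk))
    (hhol : ∀ Vk ∈ K, Differentiable ℂ fun z => D z Vk)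
    (hloc : ∀ Vk ∈ K, ∃ O : Set M, IsOpen O ∧ D 0 Vk ∈ O ∧
      ∃ Γ : M → PBond P 0 → Matrix (Fin 2) (Fin 2) ℂ,
        (∀ b a c, DifferentiableOn ℂ (fun m => Γ m b a c) O) ∧
        (∀ m ∈ O, ∀ b a c, ‖Γ m b a c‖ ≤ 𝓐₀) ∧
        ∀ (p B' : VecField P k E3) (Vk' : GaugeField P k SU2), D (cplxVec p, cplxVec B') Vk' ∈ O →
          ∃ U' : GaugeField P 0 SU2, (∀ b, Γ (D (cplxVec p, cplxVec B') Vk') b = ((U' b : SU2) : Matrix (Fin 2) (Fin 2) ℂ)) ∧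
            IsMinimizerB av reg 𝔅 (avgFamily av (cfg p B' Vk')) U') :
    ∃ R : ℝ, 0 < R ∧ ∀ Vk ∈ K,
      ∃ Ũ : VecField P k (EuclideanSpace ℂ (Fin 3)) × VecField P k (EuclideanSpace ℂ (Fin 3)) → PBond P 0 → Matrix (Fin 2) (Fin 2) ℂ,
        (∀ b a c, DifferentiableOn ℂ (fun z => Ũ z b a c) (ball 0 R)) ∧
        (∀ z ∈ ball (0 : VecField P k (EuclideanSpace ℂ (Fin 3)) × VecField P k (EuclideanSpace ℂ (Fin 3))) R, ∀ b a c, ‖Ũ z b a c‖ ≤ 𝓐₀) ∧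
        ∀ p B' : VecField P k E3, ‖p‖ < R → ‖B'‖ < R → ∃ U' : GaugeField P 0 SU2,
          (∀ b, Ũ (cplxVec p, cplxVec B') b = ((U' b : SU2) : Matrix (Fin 2) (Fin 2) ℂ)) ∧
            IsMinimizerB av reg 𝔅 (avgFamily av (cfg p B' Vk)) U' := by
  -- the good charts: a chart `Γ` with the three properties on `O`
  obtain ⟨R, hR, hall⟩ := exists_uniform_radius_of_isCompact (d := D) (z₀ := 0) hK
    (fun O => ∃ Γ : M → PBond P 0 → Matrix (Fin 2) (Fin 2) ℂ,
        (∀ b a c, DifferentiableOn ℂ (fun m => Γ m b a c) O) ∧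
        (∀ m ∈ O, ∀ b a c, ‖Γ m b a c‖ ≤ 𝓐₀) ∧
        ∀ (p B' : VecField P k E3) (Vk' : GaugeField P k SU2), D (cplxVec p, cplxVec B') Vk' ∈ O →
          ∃ U' : GaugeField P 0 SU2, (∀ b, Γ (D (cplxVec p, cplxVec B') Vk') b = ((U' b : SU2) : Matrix (Fin 2) (Fin 2) ℂ)) ∧
            IsMinimizerB av reg 𝔅 (avgFamily av (cfg p B' Vk')) U')
    hcont (fun Vk hVk => hloc Vk hVk)
  refine ⟨R, hR, fun Vk hVk => ?_⟩
  obtain ⟨O, ⟨Γ, hΓd, hΓb, hΓr⟩, hmaps⟩ := hall Vk hVk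
  refine ⟨fun z => Γ (D z Vk), fun b a c => ?_, fun z hz b a c => hΓb _ (hmaps z hz) b a c, fun p B' hp hB' => ?_⟩
  · exact (hΓd b a c).comp (hhol Vk hVk).differentiableOn fun z hz => hmaps z hz
  · have hz : (cplxVec p, cplxVec B') ∈ ball (0 : VecField P k (EuclideanSpace ℂ (Fin 3)) × VecField P k (EuclideanSpace ℂ (Fin 3))) R := by
      rw [mem_ball_zero_iff, Prod.norm_def, norm_cplxVec, norm_cplxVec]
      exact max_lt hp hB'
    exact hΓr p B' Vk (hmaps _ hz)

end Generic

/-! ## §3  The letter (J0′) at the record's chart data, bond datum -/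

section Record

variable {P : Params} {k : ℕ} (Λ : Set (Site P k)) (lo hi : Fin P.d → ℤ)

/-- ★★★ **THE LETTER (J0′) `hMin` OF p586362 ∕ p589595 WITH ONE RADIUS, FROM LOCAL HOLOMORPHIC MINIMISER CHARTS ON THE LEVEL-0 COMPLEX CONFIGURATION SPACE.**  For the chart family
`(p, B′) ↦ Q_k^{s*}(exp(iB′)·ext(exp(ip)V_k))` of [IV] Prop. 1 (any averaging `av`, class `reg`, determining set `𝔅` for the (2.12) problem; `ext` free), a compact set `K` of base fields
`V_k` (e.g. `univ`: `SU(2)^{bonds}` is compact), and at every `V_k ∈ K` a LOCAL CHART: an open `O` of `PBond P 0 → M₂(ℂ)` containing the complexified datum `datumC Λ lo hi ↑V_k 0 0` and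
`Γ` with entries ℂ-differentiable on `O`, bounded by `𝓐₀` on `O`, and which at every REAL point `datumC Λ lo hi ↑V′_k (p, B′) ∈ O` IS some `SU(2)` configuration minimal for the datum
`avgFamily av (Q_k^{s*}(exp(iB′)·ext(exp(ip)V′_k)))` — THEN there is ONE `R > 0` such that for EVERY `V_k ∈ K`: «∃ Ũ on `ball 0 R` with ℂ-differentiable entries bounded by `𝓐₀` which
at every real `(p, B′)`, `‖p‖, ‖B′‖ < R`, IS SOME (2.12) MINIMISER of that point's datum» — the body of `hMin`.  The charts are what the complex implicit-function route supplies
locally ([15] Prop. 9 ∕ Sect. G); the uniform `R` of print is here qualitative (compactness). [cite: Balaban1985Variational, Thm 1 p.279, Prop. 9 (190) p.309; Balaban1989LargeFieldI, (1.74) p.192, Prop. 1 p.194 (last clause); Balaban1988Convergent, (2.11)–(2.14) pp.256–257] -/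
theorem hMin_of_localCharts (av : ∀ j, Averaging P j SU2) (reg : Set (GaugeField P 0 SU2)) (𝔅 : BDetSet P)
    (ext : GaugeField P k SU2 → GaugeField P k SU2) {K : Set (GaugeField P k SU2)} (hK : IsCompact K) {𝓐₀ : ℝ}
    (hloc : ∀ Vk ∈ K, ∃ O : Set (PBond P 0 → Matrix (Fin 2) (Fin 2) ℂ), IsOpen O ∧
      datumC Λ lo hi (coeField Vk) (0 : VecField P k (EuclideanSpace ℂ (Fin 3))) (0 : VecField P k (EuclideanSpace ℂ (Fin 3))) ∈ O ∧
      ∃ Γ : (PBond P 0 → Matrix (Fin 2) (Fin 2) ℂ) → PBond P 0 → Matrix (Fin 2) (Fin 2) ℂ,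
        (∀ b a c, DifferentiableOn ℂ (fun Q => Γ Q b a c) O) ∧
        (∀ Q ∈ O, ∀ b a c, ‖Γ Q b a c‖ ≤ 𝓐₀) ∧
        ∀ (p B' : VecField P k E3) (Vk' : GaugeField P k SU2), datumC Λ lo hi (coeField Vk') (cplxVec p) (cplxVec B') ∈ O →
          ∃ U' : GaugeField P 0 SU2,
            (∀ b, Γ (datumC Λ lo hi (coeField Vk') (cplxVec p) (cplxVec B')) b = ((U' b : SU2) : Matrix (Fin 2) (Fin 2) ℂ)) ∧
              IsMinimizerB av reg 𝔅 (avgFamily av (qsstarGIter0 k (expMul su2Chart B' (ext (expMul su2Chart p Vk'))))) U') :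
    ∃ R : ℝ, 0 < R ∧ ∀ Vk ∈ K,
      ∃ Ũ : VecField P k (EuclideanSpace ℂ (Fin 3)) × VecField P k (EuclideanSpace ℂ (Fin 3)) → PBond P 0 → Matrix (Fin 2) (Fin 2) ℂ,
        (∀ b a c, DifferentiableOn ℂ (fun z => Ũ z b a c) (ball 0 R)) ∧
        (∀ z ∈ ball (0 : VecField P k (EuclideanSpace ℂ (Fin 3)) × VecField P k (EuclideanSpace ℂ (Fin 3))) R, ∀ b a c, ‖Ũ z b a c‖ ≤ 𝓐₀) ∧
        ∀ p B' : VecField P k E3, ‖p‖ < R → ‖B'‖ < R → ∃ U' : GaugeField P 0 SU2,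
          (∀ b, Ũ (cplxVec p, cplxVec B') b = ((U' b : SU2) : Matrix (Fin 2) (Fin 2) ℂ)) ∧
            IsMinimizerB av reg 𝔅 (avgFamily av (qsstarGIter0 k (expMul su2Chart B' (ext (expMul su2Chart p Vk))))) U' := by
  refine exists_minimiserFamily_of_localCharts av reg 𝔅
    (fun z Vk => datumC Λ lo hi (coeField Vk) z.1 z.2)
    (fun p B' Vk => qsstarGIter0 k (expMul su2Chart B' (ext (expMul su2Chart p Vk)))) hK
    (fun Vk _ => (continuous_datumC_coeField Λ lo hi).continuousAt)
    (fun Vk _ => (differentiable_datumC Λ lo hi (coeField Vk)))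
    (fun Vk hVk => ?_)
  obtain ⟨O, hO, h0, Γ, hΓ⟩ := hloc Vk hVk
  exact ⟨O, hO, h0, Γ, hΓ⟩

end Record

end Literature.MathematicalPhysics.QuantumFieldTheory.Balaban1983to89.B15Prop1MinimiserFamilyPatchingB

end
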